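import Literature.NumberTheory.GaloisRepresentations.LubinTateUnramifiedTowerIwasawa
import Literature.NumberTheory.EllipticCurves.IwasawaAlgebraGroupRingLimitProduct
import HarnessLib

/-!
# `lim←_{Tr} 𝒪_{E_m} ≅ (𝒪_F⟦X⟧)^{ℤ/d} = 𝒪_F[ℤ/d]⟦X⟧` for a GENERAL unramified tower `[E_m : F] = d·p^m` (`p ∤ d`),
# the Frobenius acting as (shift of the `ℤ/d`-index) ⊗ (multiplication by `1 + X`)

De Shalit, *Iwasawa theory of elliptic curves with complex multiplication* (1987), Ch. I §3.1 ("`ℤ_p⟦𝒢⟧ = Λ[Δ]`"), §3.8 (16)–(17),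
Ch. III §1.3; Washington (1997) Thm. 7.1.  `LubinTateUnramifiedTowerIwasawa` treats `ℤ_p`-towers (`[E_m : F] = p^m`).  The unramified
layers of the two-variable towers of de Shalit III §1.3 (completions of `K(𝔤𝔭̄^{m+1})` at a prime above `𝔭`) form a tower whose
Galois group over `F` is PROCYCLIC `≅ ℤ/d × ℤ_p` with a prime-to-`p` part `d` (from `(𝒪_K/𝔤)ˣ`); after discarding repeated layers its
degrees are `d·p^m`.  For such a tower `E₀ ≤ E₁ ≤ ⋯ ⊆ F^{nr}` of finite Galois extensions with `[E_m : F] = d·p^m`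
(`Gal(E_m/F) = ⟨φ_m⟩ ≅ ℤ/dp^mℤ`, `φ_m = σ₀|_{E_m}`) and trace-coherent integral normal generators `θ_m`, the chain

  `lim←_{Tr} 𝒪_{E_m}` —(coordinates)→ compatible functions on the `Gal(E_m/F)` —(`i ↦ φ_m^i`)→ compatible functions on the `ℤ/dp^m`
  —(CRT + Amice per `ℤ/d`-component, `IwasawaAlgebraGroupRingLimitProduct`)→ `(𝒪_F⟦X⟧)^{ℤ/d}`

is a bijection under which the Frobenius becomes `(g_j)_j ↦ ((1+X)·g_{j−1})_j`:

* `towerRestrict_frobPow_cyclic`, `frobPow_bijective_cyclic`, `pushforward_frobPow_iff_cyclic` — `x ↦ φ_m^x` identifies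
  `ℤ/dp^mℤ ≅ Gal(E_m/F)` compatibly with the projections and transports push-forward-coherence;
* ★★★ `existsUnique_amiceProd_of_traceCoherent` / `existsUnique_traceCoherent_of_seriesProd` — **`lim←_{Tr} 𝒪_{E_m} ≅ (𝒪_F⟦X⟧)^{ℤ/d}`**:
  every trace-coherent family `x` has a unique `g : ℤ/d → 𝒪_F⟦X⟧` with
  `g j ≡ Σ_{i ∈ ℤ/p^m} a_{x_m}(φ_m^{χ_m⁻¹(j,i)})(1+X)^i (mod ω_m)` for all `m, j` (`χ_m : ℤ/dp^m ≅ ℤ/d × ℤ/p^m` the CRT isomorphism), and conversely;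
* ★★ `amiceProd_frobPow` — **the transform of `(φ_m^t x_m)_m` is `j ↦ (1 + X)^t·g(j − t)`**: `lim←_{Tr} 𝒪_{E_m}` is the free
  `𝒪_F[ℤ/d]⟦X⟧`-module of rank one on the coherent normal basis, the generator `φ` of `Gal(E_∞/F) ≅ ℤ/d × ℤ_p` acting as `[1]·(1+X)`
  (its `ℤ_p`-part as `1 + X`, its `ℤ/d`-part through the regular representation) — de Shalit's `Λ(𝒢, 𝒪) = Λ[Δ]` in the unramified
  direction for a procyclic `𝒢` with prime-to-`p` part.

Hypotheses: `𝒪_F` is `(p)`-adically complete and `p` is not a unit of `𝒪_F`.  Everything PROVED (0 sorry, no named facts, no new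
definitions).  With `d = 1` this is `LubinTateUnramifiedTowerIwasawa` up to the trivial index `ℤ/1`.

## References

* E. de Shalit, *Iwasawa theory of elliptic curves with complex multiplication* (1987), Ch. I §3.1, §3.8 (16)–(17); Ch. III §1.3. [deShalit1987]
* L. C. Washington, *Introduction to Cyclotomic Fields*, 2nd ed. (1997), §7.1 Thm. 7.1. [Washington1997]
-/

noncomputable section

namespace Literature.NumberTheory.GaloisRepresentations

section UnramifiedTowerIwasawaCyclic

open GaloisRepresentations.IsNonarchimedeanLocalField LubinTate ValuativeRel Field Finset
open Literature.NumberTheory.EllipticCurves.IwasawaOmega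

variable {F : Type} [Field F] [ValuativeRel F] [TopologicalSpace F] [IsNonarchimedeanLocalField F]

attribute [local instance] ltNormUniformSpace ltNormIsUniformAddGroup rk1 nF nE fintypeResidueField

variable (p : ℕ) [hp : Fact p.Prime] (d : ℕ) [NeZero d] (hd : d.Coprime p)
variable (E : ℕ → IntermediateField F (AlgebraicClosure F)) [∀ m, FiniteDimensional F (E m)] [∀ m, Normal F (E m)]
  [∀ m, IsGalois F (E m)] (hmono : Monotone E) (hE : ∀ m, E m ≤ maxUnramified F) (hdeg : ∀ m, Module.finrank F (E m) = d * p ^ m)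
  {σ₀ : absoluteGaloisGroup F} (hσ₀ : IsAbsArithFrob σ₀)

/-! ### `ℤ/dp^mℤ ≅ Gal(E_m/F)`, `i ↦ φ_m^i`, compatibly with the projections -/

omit hp [NeZero d] in
include hE hdeg hσ₀ in
/-- `φ_m^{dp^m} = 1`: powers of the Frobenius of `E_m` only depend on the exponent modulo `dp^m = [E_m:F]`.
[cite: SerreLocalFields1979, Ch. I §4 Prop. 10] -/
theorem frobPow_eq_frobPow_mod_cyclic (m i : ℕ) :
    ((absoluteGaloisGroup.toAlgEquiv F σ₀).restrictNormal (E m)) ^ i =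
      ((absoluteGaloisGroup.toAlgEquiv F σ₀).restrictNormal (E m)) ^ (i % (d * p ^ m)) := by
  rw [← hdeg m, ← orderOf_restrictNormal_eq_finrank (E m) (hE m) hσ₀, pow_mod_orderOf]

include hE hdeg hσ₀ in
/-- **Compatibility with the projections**: `(φ_{m+1}^{y})|_{E_m} = φ_m^{y mod dp^m}`. [cite: deShalit1987, Ch. I §3.1] -/
theorem towerRestrict_frobPow_cyclic (m : ℕ) (y : ZMod (d * p ^ (m + 1))) :
    towerRestrict (hmono (Nat.le_succ m)) (((absoluteGaloisGroup.toAlgEquiv F σ₀).restrictNormal (E (m + 1))) ^ y.val) =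
      ((absoluteGaloisGroup.toAlgEquiv F σ₀).restrictNormal (E m)) ^
        (ZMod.castHom (mul_pow_dvd_mul_pow_succ p d m) (ZMod (d * p ^ m)) y).val := by
  rw [map_pow, towerRestrict_restrictNormal, ZMod.castHom_apply, ZMod.cast_eq_val, ZMod.val_natCast]
  exact frobPow_eq_frobPow_mod_cyclic p d E hE hdeg hσ₀ m y.val

include hE hdeg hσ₀ in
/-- **`x ↦ φ_m^x` is a bijection `ℤ/dp^mℤ → Gal(E_m/F)`** (`Gal(E_m/F) = ⟨φ_m⟩` of order `[E_m:F] = dp^m`).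
[cite: SerreLocalFields1979, Ch. I §4 Prop. 10] -/
theorem frobPow_bijective_cyclic (m : ℕ) :
    Function.Bijective fun x : ZMod (d * p ^ m) => ((absoluteGaloisGroup.toAlgEquiv F σ₀).restrictNormal (E m)) ^ x.val := by
  have hb := bijective_restrictNormal_pow (E m) (hE m) hσ₀
  -- `x ↦ ⟨x.val, _⟩ : ZMod (dp^m) → Fin [E_m:F]` is a bijection
  have hv : Function.Bijective fun x : ZMod (d * p ^ m) => (⟨x.val, (hdeg m).symm ▸ ZMod.val_lt x⟩ : Fin (Module.finrank F (E m))) := by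
    refine ⟨fun x y hxy => ZMod.val_injective _ (by simpa using hxy), fun i => ⟨(i.val : ZMod (d * p ^ m)), Fin.ext ?_⟩⟩
    simp only [ZMod.val_natCast]
    exact Nat.mod_eq_of_lt ((hdeg m) ▸ i.2)
  exact hb.comp hv

include hE hdeg hσ₀ in
/-- **Transport of push-forward-coherence** along `x ↦ φ_m^x`: for functions `a_m` on `Gal(E_m/F)` and `a_{m+1}` on `Gal(E_{m+1}/F)`,
`a_m(ρ) = Σ_{σ|_{E_m} = ρ} a_{m+1}(σ)` for all `ρ` iff `a_m(φ_m^x) = Σ_{y ↦ x} a_{m+1}(φ_{m+1}^y)` for all `x ∈ ℤ/dp^mℤ`.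
[cite: deShalit1987, Ch. I §3.1] -/
theorem pushforward_frobPow_iff_cyclic (m : ℕ) (a₁ : (E m ≃ₐ[F] E m) → 𝒪[F]) (a₂ : (E (m + 1) ≃ₐ[F] E (m + 1)) → 𝒪[F]) :
    open scoped Classical in
    (∀ ρ : E m ≃ₐ[F] E m, a₁ ρ = ∑ σ ∈ univ.filter (fun σ : E (m + 1) ≃ₐ[F] E (m + 1) => towerRestrict (hmono (Nat.le_succ m)) σ = ρ), a₂ σ) ↔
      ∀ x : ZMod (d * p ^ m), a₁ (((absoluteGaloisGroup.toAlgEquiv F σ₀).restrictNormal (E m)) ^ x.val) =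
        ∑ y ∈ univ.filter (fun y : ZMod (d * p ^ (m + 1)) => ZMod.castHom (mul_pow_dvd_mul_pow_succ p d m) (ZMod (d * p ^ m)) y = x),
          a₂ (((absoluteGaloisGroup.toAlgEquiv F σ₀).restrictNormal (E (m + 1))) ^ y.val) := by
  classical
  have hb₁ := frobPow_bijective_cyclic p d E hE hdeg hσ₀ m
  have hb₂ := frobPow_bijective_cyclic p d E hE hdeg hσ₀ (m + 1)
  -- the fibre sums correspond under `y ↦ φ_{m+1}^y`
  have hfib : ∀ x : ZMod (d * p ^ m),
      ∑ σ ∈ univ.filter (fun σ : E (m + 1) ≃ₐ[F] E (m + 1) =>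
        towerRestrict (hmono (Nat.le_succ m)) σ = ((absoluteGaloisGroup.toAlgEquiv F σ₀).restrictNormal (E m)) ^ x.val), a₂ σ =
      ∑ y ∈ univ.filter (fun y : ZMod (d * p ^ (m + 1)) => ZMod.castHom (mul_pow_dvd_mul_pow_succ p d m) (ZMod (d * p ^ m)) y = x),
        a₂ (((absoluteGaloisGroup.toAlgEquiv F σ₀).restrictNormal (E (m + 1))) ^ y.val) := by
    intro x
    symm
    refine sum_bij (fun y _ => ((absoluteGaloisGroup.toAlgEquiv F σ₀).restrictNormal (E (m + 1))) ^ y.val) (fun y hy => ?_)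
      (fun y₁ _ y₂ _ h => hb₂.1 h) (fun σ hσ => ?_) (fun y _ => rfl)
    · rw [mem_filter] at hy ⊢
      refine ⟨mem_univ _, ?_⟩
      rw [towerRestrict_frobPow_cyclic p d E hmono hE hdeg hσ₀, hy.2]
    · rw [mem_filter] at hσ
      obtain ⟨y, rfl⟩ := hb₂.2 σ
      refine ⟨y, ?_, rfl⟩
      rw [mem_filter]
      refine ⟨mem_univ _, hb₁.1 ?_⟩
      simp only
      rw [← towerRestrict_frobPow_cyclic p d E hmono hE hdeg hσ₀]
      exact hσ.2
  constructor
  · intro h x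
    rw [h, hfib]
  · intro h ρ
    obtain ⟨x, rfl⟩ := hb₁.2 ρ
    rw [hfib]
    exact h x

/-! ### `lim←_{Tr} 𝒪_{E_m} ≅ (𝒪_F⟦X⟧)^{ℤ/d}` -/

include hE hdeg hσ₀ in
/-- ★★★ **The `ℤ/d`-tuple of Iwasawa–Amice transforms of a trace-coherent family**: for trace-coherent normal integral generators `θ`
and a family `x = (x_m ∈ 𝒪_{E_m})` with `Tr x_{m+1} = x_m`, there is a UNIQUE `g : ℤ/d → 𝒪_F⟦X⟧` with
`g j ≡ Σ_{i ∈ ℤ/p^m} a_{x_m}(φ_m^{χ_m⁻¹(j,i)})·(1+X)^i (mod (1+X)^{p^m} − 1)` for all `m` and `j` (`a_{x_m}` the coordinates of `x_m` in the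
basis `(σθ_m)_σ`, `χ_m : ℤ/dp^m ≅ ℤ/d × ℤ/p^m` the Chinese remainder isomorphism). [cite: deShalit1987, Ch. I §3.1, §3.8 (17)] -/
theorem existsUnique_amiceProd_of_traceCoherent [IsAdicComplete (Ideal.span {(p : 𝒪[F])}) 𝒪[F]] {θ : ∀ m, unitBall (E m)}
    (hθ : ∀ m, IsIntegralNormalGen (E m) (θ m)) (hcoh : ∀ m, unitBallTrace (hmono (Nat.le_succ m)) (θ (m + 1)) = θ m)
    (x : ∀ m, unitBall (E m)) (hx : ∀ m, unitBallTrace (hmono (Nat.le_succ m)) (x (m + 1)) = x m) :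
    ∃! g : ZMod d → PowerSeries 𝒪[F], ∀ m (j : ZMod d), ((1 + PowerSeries.X : PowerSeries 𝒪[F]) ^ p ^ m - 1) ∣
      g j - ∑ i : ZMod (p ^ m), PowerSeries.C ((hθ m).basis.repr (x m) (((absoluteGaloisGroup.toAlgEquiv F σ₀).restrictNormal (E m)) ^
        ((ZMod.chineseRemainder (hd.pow_right m)).symm (j, i)).val)) * (1 + PowerSeries.X) ^ i.val := by
  classical
  refine existsUnique_forall_omega_dvd_sub_amice_prod p d hd
    (fun m (y : ZMod (d * p ^ m)) => (hθ m).basis.repr (x m) (((absoluteGaloisGroup.toAlgEquiv F σ₀).restrictNormal (E m)) ^ y.val))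
    fun m => ?_
  exact (pushforward_frobPow_iff_cyclic p d E hmono hE hdeg hσ₀ m _ _).mp
    (fun ρ => (traceCoherent_iff_pushforward E hmono hθ hcoh x).mp hx m ρ)

include hE hdeg hσ₀ in
/-- ★★★ **Conversely every `g : ℤ/d → 𝒪_F⟦X⟧` is the transform of a UNIQUE trace-coherent family** (`p` not a unit of `𝒪_F`): with
`existsUnique_amiceProd_of_traceCoherent` this is the bijection `lim←_{Tr} 𝒪_{E_m} ≅ (𝒪_F⟦X⟧)^{ℤ/d} = 𝒪_F[ℤ/d]⟦X⟧ = Λ(ℤ/d × ℤ_p, 𝒪_F)`.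
[cite: deShalit1987, Ch. I §3.1, §3.8 (17)] -/
theorem existsUnique_traceCoherent_of_seriesProd [IsAdicComplete (Ideal.span {(p : 𝒪[F])}) 𝒪[F]] (hI : Ideal.span {(p : 𝒪[F])} ≠ ⊤)
    {θ : ∀ m, unitBall (E m)} (hθ : ∀ m, IsIntegralNormalGen (E m) (θ m))
    (hcoh : ∀ m, unitBallTrace (hmono (Nat.le_succ m)) (θ (m + 1)) = θ m) (g : ZMod d → PowerSeries 𝒪[F]) :
    ∃! x : ∀ m, unitBall (E m), (∀ m, unitBallTrace (hmono (Nat.le_succ m)) (x (m + 1)) = x m) ∧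
      ∀ m (j : ZMod d), ((1 + PowerSeries.X : PowerSeries 𝒪[F]) ^ p ^ m - 1) ∣
        g j - ∑ i : ZMod (p ^ m), PowerSeries.C ((hθ m).basis.repr (x m) (((absoluteGaloisGroup.toAlgEquiv F σ₀).restrictNormal (E m)) ^
          ((ZMod.chineseRemainder (hd.pow_right m)).symm (j, i)).val)) * (1 + PowerSeries.X) ^ i.val := by
  classical
  -- the compatible family of functions on the `ℤ/dp^m`
  obtain ⟨b, ⟨hb, hbg⟩, hbuniq⟩ := existsUnique_compatible_amice_prod p d hd hI g
  -- transport to functions on the Galois groups through the bijections `i ↦ φ_m^i`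
  have hbij := fun m => frobPow_bijective_cyclic p d E hE hdeg hσ₀ m
  obtain ⟨a, ha⟩ : ∃ a : ∀ m, (E m ≃ₐ[F] E m) → 𝒪[F],
      ∀ m (i : ZMod (d * p ^ m)), a m (((absoluteGaloisGroup.toAlgEquiv F σ₀).restrictNormal (E m)) ^ i.val) = b m i := by
    refine ⟨fun m ρ => b m (Function.surjInv (hbij m).2 ρ), fun m i => ?_⟩
    exact congrArg (b m) ((hbij m).1 (Function.surjInv_eq (hbij m).2 _))
  have hapush : ∀ m (ρ : E m ≃ₐ[F] E m), a m ρ = ∑ σ ∈ univ.filter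
      (fun σ : E (m + 1) ≃ₐ[F] E (m + 1) => towerRestrict (hmono (Nat.le_succ m)) σ = ρ), a (m + 1) σ := by
    intro m
    refine (pushforward_frobPow_iff_cyclic p d E hmono hE hdeg hσ₀ m (a m) (a (m + 1))).mpr fun i => ?_
    rw [ha, hb m i]
    exact sum_congr rfl fun y _ => by rw [ha]
  -- the trace-coherent family with these coordinates
  obtain ⟨x, ⟨hx, hxa⟩, hxuniq⟩ := exists_unique_traceCoherent_of_pushforward E hmono hθ hcoh a hapush
  refine ⟨x, ⟨hx, fun m j => ?_⟩, ?_⟩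
  · have e : (∑ i : ZMod (p ^ m), PowerSeries.C ((hθ m).basis.repr (x m)
        (((absoluteGaloisGroup.toAlgEquiv F σ₀).restrictNormal (E m)) ^ ((ZMod.chineseRemainder (hd.pow_right m)).symm (j, i)).val)) *
          (1 + PowerSeries.X) ^ i.val) =
        ∑ i : ZMod (p ^ m), PowerSeries.C (b m ((ZMod.chineseRemainder (hd.pow_right m)).symm (j, i))) * (1 + PowerSeries.X) ^ i.val :=
      sum_congr rfl fun i _ => by rw [hxa, ha]
    rw [e]
    exact hbg m j
  · rintro x' ⟨hx', hx'g⟩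
    -- the coordinate functions of `x'` on the `ℤ/dp^m` form a compatible family with transform `g`, hence equal `b`
    have hb' : (fun m (i : ZMod (d * p ^ m)) => (hθ m).basis.repr (x' m) (((absoluteGaloisGroup.toAlgEquiv F σ₀).restrictNormal (E m)) ^ i.val)) = b := by
      refine hbuniq _ ⟨fun m i => ?_, hx'g⟩
      exact (pushforward_frobPow_iff_cyclic p d E hmono hE hdeg hσ₀ m _ _).mp
        (fun ρ => (traceCoherent_iff_pushforward E hmono hθ hcoh x').mp hx' m ρ) i
    refine hxuniq x' ⟨hx', fun m ρ => ?_⟩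
    obtain ⟨i, rfl⟩ := (hbij m).2 ρ
    rw [ha, ← hb']

/-! ### The Frobenius is (shift of the `ℤ/d`-index) ⊗ (multiplication by `1 + X`) -/

include hE hdeg hσ₀ in
/-- In the coordinates on `ℤ/dp^mℤ` the power `φ_m^t` of the Frobenius is the shift `i ↦ i − t`: `a_{φ_m^t x}(φ_m^i) = a_x(φ_m^{i−t})`.
[cite: deShalit1987, Ch. I §3.1] -/
theorem repr_frobPow_frobPow_cyclic {m : ℕ} {θ : unitBall (E m)} (hθ : IsIntegralNormalGen (E m) θ) (x : unitBall (E m)) (t : ℕ)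
    (i : ZMod (d * p ^ m)) :
    hθ.basis.repr (unitBallEquiv (E m) (((absoluteGaloisGroup.toAlgEquiv F σ₀).restrictNormal (E m)) ^ t) x)
        (((absoluteGaloisGroup.toAlgEquiv F σ₀).restrictNormal (E m)) ^ i.val) =
      hθ.basis.repr x (((absoluteGaloisGroup.toAlgEquiv F σ₀).restrictNormal (E m)) ^ (i - t).val) := by
  rw [hθ.repr_unitBallEquiv]
  congr 1
  -- `φ^{-t} φ^{i} = φ^{(i-t)}`: both have the same product with `φ^t`
  have h1 : ((absoluteGaloisGroup.toAlgEquiv F σ₀).restrictNormal (E m)) ^ (i - t).val *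
      ((absoluteGaloisGroup.toAlgEquiv F σ₀).restrictNormal (E m)) ^ t =
      ((absoluteGaloisGroup.toAlgEquiv F σ₀).restrictNormal (E m)) ^ i.val := by
    rw [← pow_add, frobPow_eq_frobPow_mod_cyclic p d E hE hdeg hσ₀ m ((i - t).val + t)]
    congr 1
    have h2 : ((i - t) + t : ZMod (d * p ^ m)).val = ((i - t).val + t) % (d * p ^ m) := by
      rw [ZMod.val_add, ZMod.val_natCast, Nat.add_mod_mod]
    rw [← h2, sub_add_cancel]
  rw [← h1, (Commute.pow_pow_self _ _ _).eq, inv_mul_cancel_left]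

include hE hdeg hσ₀ in
/-- ★★ **The Frobenius power `φ^t` is (shift by `t`) ⊗ (multiplication by `(1 + X)^t`)**: if `g : ℤ/d → 𝒪_F⟦X⟧` is the transform
of the trace-coherent family `x`, then `j ↦ (1 + X)^t·g(j − t)` is the transform of `(φ_m^t x_m)_m` — so under
`lim←_{Tr} 𝒪_{E_m} ≅ 𝒪_F[ℤ/d]⟦X⟧` the generator `φ` of `Gal(E_∞/F) ≅ ℤ/d × ℤ_p` acts as `[1]·(1 + X)`: `lim←_{Tr} 𝒪_{E_m}` is free of rank
one over `Λ(ℤ/d × ℤ_p, 𝒪_F) = 𝒪_F[ℤ/d]⟦X⟧` on the coherent normal basis. [cite: deShalit1987, Ch. I §3.1 ("`ℤ_p⟦𝒢⟧ = Λ[Δ]`")] -/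
theorem amiceProd_frobPow {θ : ∀ m, unitBall (E m)} (hθ : ∀ m, IsIntegralNormalGen (E m) (θ m)) (x : ∀ m, unitBall (E m))
    (g : ZMod d → PowerSeries 𝒪[F])
    (hg : ∀ m (j : ZMod d), ((1 + PowerSeries.X : PowerSeries 𝒪[F]) ^ p ^ m - 1) ∣
      g j - ∑ i : ZMod (p ^ m), PowerSeries.C ((hθ m).basis.repr (x m) (((absoluteGaloisGroup.toAlgEquiv F σ₀).restrictNormal (E m)) ^
        ((ZMod.chineseRemainder (hd.pow_right m)).symm (j, i)).val)) * (1 + PowerSeries.X) ^ i.val) (t m : ℕ) (j : ZMod d) :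
    ((1 + PowerSeries.X : PowerSeries 𝒪[F]) ^ p ^ m - 1) ∣
      (1 + PowerSeries.X) ^ t * g (j - t) - ∑ i : ZMod (p ^ m), PowerSeries.C ((hθ m).basis.repr
        (unitBallEquiv (E m) (((absoluteGaloisGroup.toAlgEquiv F σ₀).restrictNormal (E m)) ^ t) (x m))
          (((absoluteGaloisGroup.toAlgEquiv F σ₀).restrictNormal (E m)) ^ ((ZMod.chineseRemainder (hd.pow_right m)).symm (j, i)).val)) *
            (1 + PowerSeries.X) ^ i.val := by
  have e : (∑ i : ZMod (p ^ m), PowerSeries.C ((hθ m).basis.repr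
      (unitBallEquiv (E m) (((absoluteGaloisGroup.toAlgEquiv F σ₀).restrictNormal (E m)) ^ t) (x m))
        (((absoluteGaloisGroup.toAlgEquiv F σ₀).restrictNormal (E m)) ^ ((ZMod.chineseRemainder (hd.pow_right m)).symm (j, i)).val)) *
          (1 + PowerSeries.X) ^ i.val) =
      ∑ i : ZMod (p ^ m), PowerSeries.C ((hθ m).basis.repr (x m)
        (((absoluteGaloisGroup.toAlgEquiv F σ₀).restrictNormal (E m)) ^ ((ZMod.chineseRemainder (hd.pow_right m)).symm (j, i) - t).val)) *
          (1 + PowerSeries.X) ^ i.val :=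
    sum_congr rfl fun i _ => by rw [repr_frobPow_frobPow_cyclic p d E hE hdeg hσ₀]
  rw [e]
  exact omega_dvd_pow_mul_amice_sub_amice_translate p d hd m
    (fun y : ZMod (d * p ^ m) => (hθ m).basis.repr (x m) (((absoluteGaloisGroup.toAlgEquiv F σ₀).restrictNormal (E m)) ^ y.val))
    g (hg m) t j

include hE hdeg hσ₀ in
/-- ★ **The Frobenius itself**: the transform of `(φ_m x_m)_m` is `j ↦ (1 + X)·g(j − 1)` (`t = 1` of `amiceProd_frobPow`, with the
Frobenius of `𝒪_{E_m}` written as the tree's `frobUnitBall`). [cite: deShalit1987, Ch. I §3.1] -/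
theorem amiceProd_frob {θ : ∀ m, unitBall (E m)} (hθ : ∀ m, IsIntegralNormalGen (E m) (θ m)) (x : ∀ m, unitBall (E m))
    (g : ZMod d → PowerSeries 𝒪[F])
    (hg : ∀ m (j : ZMod d), ((1 + PowerSeries.X : PowerSeries 𝒪[F]) ^ p ^ m - 1) ∣
      g j - ∑ i : ZMod (p ^ m), PowerSeries.C ((hθ m).basis.repr (x m) (((absoluteGaloisGroup.toAlgEquiv F σ₀).restrictNormal (E m)) ^
        ((ZMod.chineseRemainder (hd.pow_right m)).symm (j, i)).val)) * (1 + PowerSeries.X) ^ i.val) (m : ℕ) (j : ZMod d) :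
    ((1 + PowerSeries.X : PowerSeries 𝒪[F]) ^ p ^ m - 1) ∣
      (1 + PowerSeries.X) * g (j - 1) - ∑ i : ZMod (p ^ m), PowerSeries.C ((hθ m).basis.repr
        ((frobUnitBall (E m) σ₀ : unitBall (E m) →+* unitBall (E m)) (x m))
          (((absoluteGaloisGroup.toAlgEquiv F σ₀).restrictNormal (E m)) ^ ((ZMod.chineseRemainder (hd.pow_right m)).symm (j, i)).val)) *
            (1 + PowerSeries.X) ^ i.val := by
  have h := amiceProd_frobPow p d hd E hE hdeg hσ₀ hθ x g hg 1 m j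
  rw [pow_one, pow_one, Nat.cast_one] at h
  exact h

end UnramifiedTowerIwasawaCyclic

end Literature.NumberTheory.GaloisRepresentations
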